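import Mathlib
import HarnessLib
import Literature.AlgebraicGeometry.Resolution.MvPolynomialKillVars
import Literature.AlgebraicGeometry.Resolution.RegularCentreLocal

/-!
# S1a — K1′ for two variables in a localised polynomial ring (centre `(X₀′, x₂)` of I-2's move 2 on the model `k[x_none, x′][1/h]`)

[OURS · L1 W4.5c · lead-1 g12; plan-1 R-F15c (I-2 := MT-a1″), my F13; tools: Literature `isWeaklyRegular_map_X`, `quotientSpanXEquiv` (MvPolynomialKillVars),
`isRegularRing_of_isLocalization` (RegularCentreLocal), Mathlib `IsWeaklyRegular.of_flat`, `IsLocalization` of quotients] — NOT statements of the manuscript;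
counted 0; AI-level work, weaker than expert review. Crux stmt-ResolutionOfSingularities-17941 `CyclicQuotientFourfolds`, line `s1a-logminvertex` v13.

For a polynomial ring `P = k[T_ι]` (`ι` finite), `h ∈ P` and two distinct variables `Tᵢ, Tⱼ`:
* `isRegular_algebraMap_X_X_away` — `(Tᵢ, Tⱼ)` is a REGULAR sequence on `P[1/h]` as soon as some point `g` with `gᵢ = gⱼ = 0` has `h(g) ≠ 0` (weak regularity by
  flat base change of `isWeaklyRegular_map_X`; properness because evaluation at `g` factors through `P[1/h]`);
* `isRegularRing_quotient_X_X_away` — `P[1/h] ⧸ (Tᵢ, Tⱼ)` is a regular ring (a localisation of the polynomial ring `P ⧸ (Tᵢ, Tⱼ)`);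
* `a1m2_eval_h_ne_zero` — for the a1 move-2 model, `h = (∏_{j ∈ 𝔽_p} (X₁′ + j·X₀′·x_none))^{2d}` does not vanish at the point `X₁′ = 1`, all other
  coordinates `0` — with `a1ModelEquiv_coverElement_one` (✓`…A1Model`) this feeds the two lemmas above for the model `k[x_none, x′][1/h]` of a move-1 producer
  chart, i.e. K1′ for the centre `(X₀′, x₂)` of move 2.
-/

set_option linter.dupNamespace false

noncomputable section

open Literature.AlgebraicGeometry.Resolution
open MvPolynomial

namespace Summit.ResolutionOfSingularities.ResolutionOfSingularities.Theorems.WildQuotientResolution.S1.KillCert.A1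

variable (k : Type) [Field k] {ι : Type} [Finite ι]

omit [Finite ι] in
/-- The span of the images of `Tᵢ, Tⱼ` in `P[1/h]` is the extension of `(Tᵢ, Tⱼ) = span (X '' {i, j})`. -/
theorem span_range_algebraMap_X_X_eq_map (hh : MvPolynomial ι k) (i j : ι) :
    Ideal.span (Set.range (![algebraMap (MvPolynomial ι k) (Localization.Away hh) (X i), algebraMap (MvPolynomial ι k) (Localization.Away hh) (X j)] :
        Fin 2 → Localization.Away hh)) =
      (Ideal.span (X '' ({i, j} : Set ι) : Set (MvPolynomial ι k))).map (algebraMap (MvPolynomial ι k) (Localization.Away hh)) := by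
  rw [Ideal.map_span]
  congr 1
  ext z
  simp only [Set.mem_range, Set.mem_image, Set.mem_insert_iff, Set.mem_singleton_iff]
  constructor
  · rintro ⟨l, rfl⟩
    fin_cases l
    · exact ⟨X i, ⟨i, Or.inl rfl, rfl⟩, rfl⟩
    · exact ⟨X j, ⟨j, Or.inr rfl, rfl⟩, rfl⟩
  · rintro ⟨_, ⟨l, rfl | rfl, rfl⟩, rfl⟩
    · exact ⟨0, rfl⟩
    · exact ⟨1, rfl⟩

omit [Finite ι] in
/-- `List.ofFn ![φ Tᵢ, φ Tⱼ] = ([i, j].map X).map φ`. -/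
theorem ofFn_algebraMap_X_X (hh : MvPolynomial ι k) (i j : ι) :
    List.ofFn (![algebraMap (MvPolynomial ι k) (Localization.Away hh) (X i), algebraMap (MvPolynomial ι k) (Localization.Away hh) (X j)] :
        Fin 2 → Localization.Away hh) =
      ((([i, j] : List ι).map (X : ι → MvPolynomial ι k)).map (algebraMap (MvPolynomial ι k) (Localization.Away hh))) := by
  simp [List.ofFn_succ]

omit [Finite ι] in
/-- ★ **Two distinct variables stay a regular sequence in `P[1/h]`** whenever `h` does not vanish at some point of `V(Tᵢ, Tⱼ)`. [OURS · L1 W4.5c; folklore] -/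
theorem isRegular_algebraMap_X_X_away (hh : MvPolynomial ι k) (i j : ι) (hij : i ≠ j) (g : ι → k) (hgi : g i = 0) (hgj : g j = 0)
    (hu : MvPolynomial.eval g hh ≠ 0) :
    RingTheory.Sequence.IsRegular (Localization.Away hh)
      (List.ofFn (![algebraMap (MvPolynomial ι k) (Localization.Away hh) (X i), algebraMap (MvPolynomial ι k) (Localization.Away hh) (X j)] :
        Fin 2 → Localization.Away hh)) := by
  haveI : Module.Flat (MvPolynomial ι k) (Localization.Away hh) := IsLocalization.flat (Localization.Away hh) (Submonoid.powers hh)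
  rw [ofFn_algebraMap_X_X]
  refine ⟨(isWeaklyRegular_map_X (R := k) [i, j] (by simp [hij])).of_flat, ?_⟩
  intro htop
  rw [smul_eq_mul, Ideal.mul_top] at htop
  -- evaluation at `g` factors through `P[1/h]` and kills `Tᵢ, Tⱼ`
  set φ : Localization.Away hh →+* k := IsLocalization.Away.lift hh (g := MvPolynomial.eval g) (Ne.isUnit hu) with hφ
  have hle : Ideal.ofList (((([i, j] : List ι).map (X : ι → MvPolynomial ι k)).map (algebraMap (MvPolynomial ι k) (Localization.Away hh)))) ≤ RingHom.ker φ := by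
    rw [Ideal.ofList, Ideal.span_le]
    intro z hz
    simp only [List.map_cons, List.map_nil, List.mem_cons, List.not_mem_nil, or_false, Set.mem_setOf_eq] at hz
    rw [SetLike.mem_coe, RingHom.mem_ker]
    rcases hz with rfl | rfl
    · rw [hφ, IsLocalization.Away.lift_eq, MvPolynomial.eval_X, hgi]
    · rw [hφ, IsLocalization.Away.lift_eq, MvPolynomial.eval_X, hgj]
  have h1 : (1 : Localization.Away hh) ∈ Ideal.ofList (((([i, j] : List ι).map (X : ι → MvPolynomial ι k)).map
      (algebraMap (MvPolynomial ι k) (Localization.Away hh)))) := by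
    rw [← htop]; trivial
  have := hle h1
  rw [RingHom.mem_ker, map_one] at this
  exact one_ne_zero this

/-- ★ **`P[1/h] ⧸ (Tᵢ, Tⱼ)` is a regular ring**: a localisation of the polynomial ring `P ⧸ (Tᵢ, Tⱼ) ≅ k[T_l : l ≠ i, j]`. [OURS · L1 W4.5c; folklore] -/
theorem isRegularRing_quotient_X_X_away (hh : MvPolynomial ι k) (i j : ι) :
    IsRegularRing (Localization.Away hh ⧸ Ideal.span (Set.range (![algebraMap (MvPolynomial ι k) (Localization.Away hh) (X i),
      algebraMap (MvPolynomial ι k) (Localization.Away hh) (X j)] : Fin 2 → Localization.Away hh))) := by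
  rw [span_range_algebraMap_X_X_eq_map]
  haveI : IsRegularRing (MvPolynomial {l : ι // l ∉ ({i, j} : Set ι)} k) := inferInstance
  haveI : IsRegularRing (MvPolynomial ι k ⧸ Ideal.span (X '' ({i, j} : Set ι) : Set (MvPolynomial ι k))) :=
    IsRegularRing.of_ringEquiv (quotientSpanXEquiv (R := k) ({i, j} : Set ι)).toRingEquiv.symm
  exact isRegularRing_of_isLocalization (A := MvPolynomial ι k ⧸ Ideal.span (X '' ({i, j} : Set ι) : Set (MvPolynomial ι k)))
    (Algebra.algebraMapSubmonoid (MvPolynomial ι k ⧸ Ideal.span (X '' ({i, j} : Set ι) : Set (MvPolynomial ι k))) (Submonoid.powers hh))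
    (Localization.Away hh ⧸ (Ideal.span (X '' ({i, j} : Set ι) : Set (MvPolynomial ι k))).map (algebraMap (MvPolynomial ι k) (Localization.Away hh)))

/-! ## The a1 move-2 model `k[x_none, x′][1/h]` -/

/-- `h = (∏_{j ∈ 𝔽_p} (X₁′ + j·(X₀′·x_none)))^{2d}` takes the value `1` at the point `X₁′ = 1`, all other coordinates `0`. -/
theorem a1m2_eval_h (p d : ℕ) [NeZero p] :
    MvPolynomial.eval (fun o : Option (Fin 4) => if o = some 1 then (1 : k) else 0)
      ((∏ j : ZMod p, (X (some 1) + C (j.val : k) * (X (some 0) * X none))) ^ (2 * d)) = 1 := by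
  rw [map_pow, map_prod]
  have hj : ∀ j : ZMod p, MvPolynomial.eval (fun o : Option (Fin 4) => if o = some 1 then (1 : k) else 0)
      (X (some 1) + C (j.val : k) * (X (some 0) * X none)) = 1 := by
    intro j
    simp
  simp_rw [hj]
  simp

/-- … hence does not vanish there. -/
theorem a1m2_eval_h_ne_zero (p d : ℕ) [NeZero p] :
    MvPolynomial.eval (fun o : Option (Fin 4) => if o = some 1 then (1 : k) else 0)
      ((∏ j : ZMod p, (X (some 1) + C (j.val : k) * (X (some 0) * X none))) ^ (2 * d)) ≠ 0 := by
  rw [a1m2_eval_h]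
  exact one_ne_zero

end Summit.ResolutionOfSingularities.ResolutionOfSingularities.Theorems.WildQuotientResolution.S1.KillCert.A1

end
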